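import Summits.ValiantsHypothesis.ValiantsHypothesis.Theorems.SymPencilPerFourPeeledTwoPencilFramePerm
import Mathlib.Algebra.Polynomial.Roots
import Mathlib.Algebra.CharZero.Infinite
import Mathlib.LinearAlgebra.FiniteDimensional.Lemmas

/-!
# Route `SymPencil` — `2 | 2` inner rank of `per_4`, PEELED case at `≤ 11` squares: PARAMETER
# EXISTENCE for the Case-A two-pencil frames, and the whole Case-A class of `hframes`
# (`--supports` stmt-ValiantsHypothesis-5674 `SdcSuperquadratic`; (8,8) column; rung currency only)

`…TwoPencilCaseAFrame.exists_caseA_frame` / `…TwoPencilFramePerm.exists_caseA_frame_perm` need a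
vector `a₀` with non-zero coordinates whose constraint values `g_k = a₀[k] (a₀ᵀΨ)_k` at the three
indices `k ≠ m` are pairwise distinct and non-zero.  **`exists_caseA_vector`**: such an `a₀`
exists (over any field of characteristic `0`) as soon as the three columns `k ≠ 3` of `Ψ` are
non-zero and contain no SWAP PAIR (`col_k = λ e_{k'}`, `col_{k'} = λ e_k`).  Proof: along the Sidon
curve `a(x) = (1, x, x³, x⁷)` (exponent sums `n_i + n_k` pairwise distinct) `g_k(a(x))` and
`g_k − g_{k'}` are univariate polynomials whose coefficients are the entries of column `k`, resp.
the swap-pair equations; a non-zero polynomial has a non-root in an infinite field.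
**`hframes_of_caseA_class`**: for every `Ψ` and every index `σ 3` whose three complementary
columns are non-zero without a swap pair, the frame required by the hypothesis `hframes` of
`…PeeledTwoPencilReduction.false_of_peeled_of_frames` EXISTS (with `a₁ ≠ 0` orthogonal to those
three columns, automatically `∉ K a₀`).  What this leaves of the (8,8,11) case analysis: the
matrices `Ψ` all of whose 3-subsets of columns contain a zero column or a swap pair, i.e.
`{≥ 2 zero columns} ∪ {one zero column + a swap pair} ∪ {two swap pairs}` — NOT treated here.

Honest framing: one class of the (8,8,11) case analysis; no cell closes here; `sdc(per_4)`, the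
crux `SdcSuperquadratic` and `VP ≠ VNP` are untouched.  No definitions, no named facts. [folklore]
-/

noncomputable section

-- single-conjunct layout: Sub = Summit, duplicated namespace component intended
set_option linter.dupNamespace false

namespace Summit.ValiantsHypothesis.ValiantsHypothesis.Theorems.SymPencilPerFourPeeledTwoPencilCaseAParams

open Matrix Finset Polynomial Module
open Summit.ValiantsHypothesis.ValiantsHypothesis.Theorems.SymPencilPerFourPeeledTwoPencilFramePerm

universe u

variable {K : Type u} [Field K]

/-- **Parameter existence for the Case-A frames.**  See the module docstring. [folklore] -/
theorem exists_caseA_vector [CharZero K] (Ψ : Matrix (Fin 4) (Fin 4) K)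
    (hc : ∀ k : Fin 4, k ≠ 3 → ∃ i, Ψ i k ≠ 0)
    (hns : ∀ k k' : Fin 4, k ≠ 3 → k' ≠ 3 → k ≠ k' →
      ¬ ((∀ i, i ≠ k' → Ψ i k = 0) ∧ (∀ i, i ≠ k → Ψ i k' = 0) ∧ Ψ k' k = Ψ k k')) :
    ∃ a : Fin 4 → K, (∀ k, a k ≠ 0) ∧
      a 0 * (a ᵥ* Ψ) 0 ≠ 0 ∧ a 1 * (a ᵥ* Ψ) 1 ≠ 0 ∧ a 2 * (a ᵥ* Ψ) 2 ≠ 0 ∧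
      a 0 * (a ᵥ* Ψ) 0 ≠ a 1 * (a ᵥ* Ψ) 1 ∧ a 0 * (a ᵥ* Ψ) 0 ≠ a 2 * (a ᵥ* Ψ) 2 ∧
      a 1 * (a ᵥ* Ψ) 1 ≠ a 2 * (a ᵥ* Ψ) 2 := by
  classical
  -- Sidon exponents and the column polynomials along the curve `(1, x, x³, x⁷)`
  let n : Fin 4 → ℕ := ![0, 1, 3, 7]
  let G : Fin 4 → K[X] := fun k => ∑ i, C (Ψ i k) * X ^ (n i + n k)
  -- the Sidon property of `(0, 1, 3, 7)`
  have hS : ∀ i k j k' : Fin 4, n i + n k = n j + n k' ↔ (i = j ∧ k = k' ∨ i = k' ∧ k = j) := by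
    decide
  have hcoe : ∀ (k : Fin 4) (e : ℕ), (G k).coeff e = ∑ j, if e = n j + n k then Ψ j k else 0 := by
    intro k e
    simp only [G, finsetSum_coeff, coeff_C_mul_X_pow]
  have hC1 : ∀ k i : Fin 4, (G k).coeff (n i + n k) = Ψ i k := by
    intro k i
    rw [hcoe, Finset.sum_eq_single i, if_pos rfl]
    · intro j _ hj
      rw [if_neg]
      intro h
      rcases (hS i k j k).1 h with ⟨hij, -⟩ | ⟨hik, hkj⟩
      · exact hj hij.symm
      · exact hj (hkj.symm.trans hik.symm)
    · simp
  have hC2 : ∀ k k' i : Fin 4, k ≠ k' → i ≠ k' → (G k').coeff (n i + n k) = 0 := by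
    intro k k' i h1 h2
    rw [hcoe]
    refine Finset.sum_eq_zero fun j _ => ?_
    rw [if_neg]
    intro h
    rcases (hS i k j k').1 h with ⟨-, hkk⟩ | ⟨hik, -⟩
    · exact h1 hkk
    · exact h2 hik
  have hG : ∀ k : Fin 4, k ≠ 3 → G k ≠ 0 := by
    intro k hk hz
    obtain ⟨i, hi⟩ := hc k hk
    exact hi (by rw [← hC1 k i, hz, coeff_zero])
  have hD : ∀ k k' : Fin 4, k ≠ 3 → k' ≠ 3 → k ≠ k' → G k - G k' ≠ 0 := by
    intro k k' hk hk' hkk' hz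
    have he : ∀ e, (G k).coeff e = (G k').coeff e := fun e => by
      have := congrArg (fun p : K[X] => p.coeff e) hz
      simpa [sub_eq_zero] using this
    refine hns k k' hk hk' hkk' ⟨fun i hi => ?_, fun i hi => ?_, ?_⟩
    · rw [← hC1 k i, he, hC2 k k' i hkk' hi]
    · rw [← hC1 k' i, ← he, hC2 k' k i (Ne.symm hkk') hi]
    · rw [← hC1 k k', ← hC1 k' k, he, add_comm]
  -- a common non-root
  set P : K[X] := X * (G 0 * G 1 * G 2) * ((G 0 - G 1) * (G 0 - G 2) * (G 1 - G 2)) with hPdef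
  have hP : P ≠ 0 := by
    refine mul_ne_zero (mul_ne_zero X_ne_zero (mul_ne_zero (mul_ne_zero (hG 0 (by decide))
      (hG 1 (by decide))) (hG 2 (by decide)))) (mul_ne_zero (mul_ne_zero
      (hD 0 1 (by decide) (by decide) (by decide)) (hD 0 2 (by decide) (by decide) (by decide)))
      (hD 1 2 (by decide) (by decide) (by decide)))
  obtain ⟨x, hx⟩ := Infinite.exists_notMem_finset P.roots.toFinset
  have hPx : P.eval x ≠ 0 := fun h => hx (Multiset.mem_toFinset.2 ((mem_roots hP).2 h))
  simp only [hPdef, eval_mul, eval_sub, eval_X] at hPx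
  have hx0 : x ≠ 0 := fun h => hPx (by rw [h]; ring)
  have hev : ∀ k : Fin 4, (G k).eval x = (fun j : Fin 4 => x ^ n j) k *
      ((fun j : Fin 4 => x ^ n j) ᵥ* Ψ) k := by
    intro k
    simp only [G, eval_finsetSum, eval_mul, eval_C, eval_pow, eval_X, Matrix.vecMul,
      dotProduct, Finset.mul_sum]
    exact Finset.sum_congr rfl fun i _ => by ring
  refine ⟨fun j => x ^ n j, fun k => pow_ne_zero _ hx0, ?_, ?_, ?_, ?_, ?_, ?_⟩
  · rw [← hev]; intro h; apply hPx; rw [h]; ring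
  · rw [← hev]; intro h; apply hPx; rw [h]; ring
  · rw [← hev]; intro h; apply hPx; rw [h]; ring
  · rw [← hev, ← hev]; intro h; apply hPx; rw [h]; ring
  · rw [← hev, ← hev]; intro h; apply hPx; rw [h]; ring
  · rw [← hev, ← hev]; intro h; apply hPx; rw [h]; ring

/-- **The whole Case-A class of `hframes`.**  If for the distinguished index `σ 3` the three
columns `σ 0, σ 1, σ 2` of `Ψ` are non-zero and contain no swap pair, the two-pencil frame
required by `…PeeledTwoPencilReduction.false_of_peeled_of_frames` exists. [folklore] -/
theorem hframes_of_caseA_class [CharZero K] (Ψ : Matrix (Fin 4) (Fin 4) K)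
    (σ : Equiv.Perm (Fin 4)) (hc : ∀ j : Fin 4, j ≠ 3 → ∃ i, Ψ i (σ j) ≠ 0)
    (hns : ∀ j j' : Fin 4, j ≠ 3 → j' ≠ 3 → j ≠ j' →
      ¬ ((∀ i, i ≠ σ j' → Ψ i (σ j) = 0) ∧ (∀ i, i ≠ σ j → Ψ i (σ j') = 0) ∧
          Ψ (σ j') (σ j) = Ψ (σ j) (σ j'))) :
    ∃ (a₀ a₁ y₀ y₁ : Fin 4 → K) (P₀₀ P₁₀ P₀₁ P₁₁ W₀ : Matrix (Fin 4) (Fin 4) K)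
      (v : Fin 4 → Fin 4 → K) (s : Fin 4 → K) (W : Matrix (Fin 4) (Fin 4) K),
      a₀ ⬝ᵥ Ψ *ᵥ y₀ = 0 ∧ a₀ ⬝ᵥ Ψ *ᵥ y₁ = 0 ∧ a₁ ⬝ᵥ Ψ *ᵥ y₀ = 0 ∧ a₁ ⬝ᵥ Ψ *ᵥ y₁ = 0 ∧
      (∀ b l, P₀₀ b l = (Matrix.of ![a₀, Pi.single b 1, y₀, Pi.single l 1]).permanent) ∧
      (∀ b l, P₁₀ b l = (Matrix.of ![a₀, Pi.single b 1, y₁, Pi.single l 1]).permanent) ∧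
      (∀ b l, P₀₁ b l = (Matrix.of ![a₁, Pi.single b 1, y₀, Pi.single l 1]).permanent) ∧
      (∀ b l, P₁₁ b l = (Matrix.of ![a₁, Pi.single b 1, y₁, Pi.single l 1]).permanent) ∧
      W₀ * P₀₀ = 1 ∧ (∀ j, P₁₀ *ᵥ v j = s j • P₀₀ *ᵥ v j) ∧ (∀ i j, i ≠ j → s i ≠ s j) ∧
      W * Matrix.of v = 1 ∧ P₁₁ - P₁₀ * W₀ * P₀₁ ≠ 0 := by
  classical
  -- parameters for the permuted matrix
  have hσ : ∀ i j : Fin 4, i ≠ σ j ↔ σ.symm i ≠ j := fun i j => by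
    rw [not_iff_not]; constructor
    · rintro rfl; simp
    · rintro rfl; simp
  obtain ⟨a, ha, g0, g1, g2, g01, g02, g12⟩ := exists_caseA_vector (Ψ.submatrix σ σ)
    (fun k hk => by
      obtain ⟨i, hi⟩ := hc k hk
      exact ⟨σ.symm i, by simpa using hi⟩)
    (fun k k' hk hk' hkk' ⟨h1, h2, h3⟩ => hns k k' hk hk' hkk'
      ⟨fun i hi => by simpa using h1 (σ.symm i) ((hσ i k').1 hi),
       fun i hi => by simpa using h2 (σ.symm i) ((hσ i k).1 hi),
       by simpa using h3⟩)
  -- `a₀ = a ∘ σ⁻¹`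
  have hvm : ∀ j, ((a ∘ σ.symm) ᵥ* Ψ) (σ j) = (a ᵥ* Ψ.submatrix σ σ) j := fun j => by
    rw [Matrix.submatrix_vecMul_equiv]; rfl
  have ha₀ : ∀ j, (a ∘ σ.symm) (σ j) = a j := fun j => by simp
  -- `a₁ ≠ 0` orthogonal to the columns `σ 0, σ 1, σ 2`
  set f := (Ψ.submatrix id fun j : Fin 3 => σ (Fin.castSucc j)).vecMulLinear with hf
  have hker : LinearMap.ker f ≠ ⊥ := LinearMap.ker_ne_bot_of_finrank_lt (by simp)
  obtain ⟨a₁, ha₁f, ha₁0⟩ := (Submodule.ne_bot_iff _).1 hker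
  have ha₁ : ∀ k, k ≠ σ 3 → (a₁ ᵥ* Ψ) k = 0 := by
    intro k hk
    have hj : σ.symm k ≠ Fin.last 3 := fun e =>
      hk (by rw [show (3 : Fin 4) = Fin.last 3 from rfl, ← e, Equiv.apply_symm_apply])
    obtain ⟨j₀, hj₀⟩ := Fin.exists_castSucc_eq.2 hj
    have e1 : f a₁ j₀ = 0 := by rw [LinearMap.mem_ker.1 ha₁f]; rfl
    have e2 : f a₁ j₀ = (a₁ ᵥ* Ψ) (σ (Fin.castSucc j₀)) := rfl
    rw [e2, hj₀] at e1
    simpa using e1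
  have hind : ∀ μ : K, a₁ ≠ μ • (a ∘ σ.symm) := by
    intro μ e
    have hμ : μ ≠ 0 := by rintro rfl; exact ha₁0 (by simpa using e)
    apply g0
    have h03 : σ 0 ≠ σ 3 := fun h => by simpa using σ.injective h
    have := ha₁ (σ 0) h03
    rw [e, Matrix.smul_vecMul, Pi.smul_apply, smul_eq_mul, hvm] at this
    rw [(mul_eq_zero.1 this).resolve_left hμ, mul_zero]
  refine ⟨a ∘ σ.symm, a₁, exists_caseA_frame_perm σ Ψ (a ∘ σ.symm) a₁ (fun k => ha _) hind ha₁
    ?_ ?_ ?_ ?_ ?_ ?_⟩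
  all_goals simp only [hvm, ha₀]
  exacts [g0, g1, g2, g01, g02, g12]

end Summit.ValiantsHypothesis.ValiantsHypothesis.Theorems.SymPencilPerFourPeeledTwoPencilCaseAParams

end
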